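import Summits.ABC.IUTFork.Repair.RHSlotReach
import Summits.ABC.IUTFork.Cor312ProvKRamified
import Literature.IUT.LogVolume.TensorPacketUnramifiedShell
import HarnessLib

/-!
# R-H ROUND 1 (D-0079 «local-height condition I06⋆», D-0107), row 15 `slotreach` — TESTER k2 (pair 12, abc-iut-rh-tst-12):
# the UNRAMIFIED-ODD refutation family versus H⋆ = `Repair.RHSlotReach.SlotReachWindow` (p457641, typer abc-iut-rh-typ-12;
# candidate of abc-iut-lens-wuc-1, CARD-slotreach b131cdee138fbe71)

PROOF-ONLY (0 `def`). Honest framing: nothing here asserts abc proved or refuted; no side on [IUTchIII] Cor. 3.12 or any author;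
the candidate is a HYPOTHESIS SHAPE (claim-tagged in its own file); typed ≠ proved; a tester's negative lemma is bookkeeping of
WHERE a hypothesis fails, not a claim about print.

QUESTION (director-abc W13 (A), tester row): «does H⋆ survive the unramified-odd refutation family that killed I06⋆ as typed»
(`Repair.CandInternal2Real.not_mem_jsq_smul_logShell_of_unramified` p432650, `Repair.EvalHonestCeiling.i06_false_of_honest` p433150).
ANSWER IN THE KERNEL:
* §1 `slotReachWindow_false_of_unramified_dictionary` — PURE ARITHMETIC: if some bad place `w` over a prime carries the unramified
  dictionary bounds `e w = 1`, `n₀ w ≤ 1`, `lam w ≤ −1`, and the orders satisfy `4·mq w ≤ mΘ 1 w` (label `j = 2`; realising ideles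
  give `mΘ = j²·mq`) with `mq w ≥ 1`, then `SlotReachWindow` is FALSE (donor slots `x ≡ w`): the `(w, 2)`-clause reads
  `mΘ − n₀ ≤ mq + lam + 2·(lam + n₀)`, i.e. `4·mq ≤ mq`. The SAME inequality `j²·m_q ≤ m_q` that kills I06⋆ there
  (`not_mem_jsq_smul_logShell_of_unramified`): on the unramified-odd stratum row 15 and I06⋆ COINCIDE (both NEG for `j ≥ 2`),
  as the CARD declares («DROPS unram-odd (0 %, = ceiling)»; `RHSlotReach.clause_iff_tame` at `e = 1`).
* §2 `nZero_le_one_of_unramified` / `lam_le_neg_one_of_unramified` — at a local field `K/ℚ_p`, `p > 2`, `e(K/ℚ_p) = 1`, the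
  candidate's OWN certification hypotheses (`hsharp`: a non-log-unit `u` with `‖u‖ ≤ ‖ϖ‖^(n₀−1)`; `hrad`: a log-unit `z` with
  `p^lam ≤ ‖z‖`) FORCE `n₀ ≤ 1` and `lam ≤ −1`, because `log_p(𝒪_K^×) = p·𝒪_K` EXACTLY
  (`Literature.IUT.LogVolume.mem_logUnits_iff_norm_le_of_unramified`, [IUTchIV] Prop. 1.2 (i) with equality).
* §3 `slotReachWindow_false_of_unramified_place` — §1 ∘ §2: at ANY datum having a bad place `w` whose completion is absolutely
  unramified over an odd `p`, with `l⋆ ≥ 2`, realising orders at label 2 and `m_q(w) ≥ 1`, H⋆ FAILS under EVERY certified dictionary.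
* §4 `l_le_absRamificationIdx_kOf_of_mem_S` / `absRamificationIdx_kOf_ne_one_of_mem_S` — SCOPE: at the GENUINE `K`-level datum
  `Cor312Prov.pilotDataOfK D K` every bad place has `e(K_w/ℚ_p) ≥ l ≥ 5` (abc-iut-w5-d054 `Cor312Prov.l_le_ramificationIdx_int_of_over_VFbad`,
  [IUTchI] Def. 3.1 (c) `l ∤ ord_v(q_v)` + Ex. 3.2 (iv) `2l ∣ ord_w(q)`), so the shared hypothesis `e(K_w/ℚ_p) = 1` of §3 and of every
  landed member of the family is UNSATISFIABLE at genuine bad places: the bite of §3 lies OFF the genuine rows — on the synthetic row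
  S-RAT (F = ℚ) of R-W's WINDOW-TABLE, where S_H itself is refuted (`Cor312LicenceSharpRat.not_pilotKummerCompatHull_settingPrVolSharp_rat_of_qPinned`,
  p438525): by law (L2) every S_H-sufficient H⋆ must fail there, and row 15 does (= ceiling).
* §5 sanity `example`: at ONE tame ramified place (`e = 2`, `j = 2`, `m_q = 1`) the clause already HOLDS — the kill is exactly the
  `e_w = 1` corner, it does not propagate to `e_w ≥ 2`.
[cite: Mochizuki2012, IUTchIV Prop. 1.2 (i) p. 10; IUTchI Def. 3.1 (c) p. 62, Ex. 3.2 (iv) p. 71] [cite: NeukirchANT1999, Ch. II Prop. (6.8)]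
[claim: Mochizuki2012, status: disputed] for every IUT locution.
-/

noncomputable section

open Set Function
open scoped Pointwise

namespace Summit.ABC.IUTFork.Repair.RHSlotReachUnramified

open Summit.ABC.IUTFork.Repair.RHSlotReach

/-! ## §1. The arithmetic kill at an unramified dictionary entry -/

/-- **k2, ARITHMETIC CORE.** If a bad place `w` over `pp` has `e w = 1`, `n₀ w ≤ 1`, `lam w ≤ −1`, and `4·mq w ≤ mΘ 1 w`,
`1 ≤ mq w` (label `j = 2`, available since `2 ≤ l⋆`), then `SlotReachWindow` fails: with donor slots `x ≡ w` its
`(w, j = 2)`-clause is `mΘ − n₀ ≤ mq + lam + 2·(lam + n₀)`, whence `4·mq ≤ mq`. [folklore] -/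
theorem slotReachWindow_false_of_unramified_dictionary {lstar : ℕ} (hl : 2 ≤ lstar)
    {Fib : Nat.Primes → Type} {bad : ∀ pp, Fib pp → Prop} {e n₀ : ∀ pp, Fib pp → ℕ} {lam : ∀ pp, Fib pp → ℝ}
    {mΘ : ∀ pp, Fin lstar → Fib pp → ℤ} {mq : ∀ pp, Fib pp → ℤ}
    (pp : Nat.Primes) (w : Fib pp) (hw : bad pp w) (he : e pp w = 1) (hn : n₀ pp w ≤ 1) (hlam : lam pp w ≤ -1)
    (hΘ : 4 * mq pp w ≤ mΘ pp ⟨1, hl⟩ w) (hq : 1 ≤ mq pp w) :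
    ¬ SlotReachWindow lstar Fib bad e n₀ lam mΘ mq := by
  intro H
  have h := H pp ⟨1, hl⟩ w hw (fun _ => w)
  simp only [he, Nat.cast_one, Int.ediv_one, div_one, Finset.sum_const, Finset.card_univ, Fintype.card_fin,
    nsmul_eq_mul, neg_neg, Int.cast_sub, Int.cast_natCast] at h
  have hn' : (n₀ pp w : ℝ) ≤ 1 := by exact_mod_cast hn
  have hΘ' : (4 : ℝ) * (mq pp w : ℝ) ≤ (mΘ pp ⟨1, hl⟩ w : ℝ) := by exact_mod_cast hΘ
  have hq' : (1 : ℝ) ≤ (mq pp w : ℝ) := by exact_mod_cast hq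
  push_cast at h
  nlinarith

/-! ## §2. At an absolutely unramified odd local field the certified dictionary is forced: `n₀ ≤ 1`, `lam ≤ −1` -/

section LocalField

open Literature.IUT.LogVolume

variable {p : ℕ} [Fact p.Prime] {K : Type} [NontriviallyNormedField K] [NormedAlgebra ℚ_[p] K] [IsUltrametricDist K]
  [ProperSpace K]

/-- **`hsharp` forces `n₀ ≤ 1` at `e = 1`, `p > 2`.** A non-log-unit `u` has `‖u‖ > p⁻¹` (`log_p(𝒪^×) = p·𝒪`), so
`‖u‖ ≤ ‖ϖ‖^(n₀ − 1) = p^{−(n₀−1)}` gives `n₀ − 1 < 1`. [cite: Mochizuki2012, IUTchIV Prop. 1.2 (i) p. 10] -/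
theorem nZero_le_one_of_unramified (hp : 2 < p) (he : absRamificationIdx p K = 1) {ϖ : K}
    (hϖ : ‖ϖ‖ = (p : ℝ) ^ (-(1 : ℝ) / ((1 : ℕ) : ℝ))) {n₀ : ℕ}
    (hsharp : ∃ u : K, ‖u‖ ≤ ‖ϖ‖ ^ ((n₀ : ℤ) - 1) ∧ u ∉ (logUnits K : Set K)) : n₀ ≤ 1 := by
  obtain ⟨u, hu, hul⟩ := hsharp
  rw [mem_logUnits_iff_norm_le_of_unramified p hp he u, not_le] at hul
  have hp1 : (1 : ℝ) < p := by exact_mod_cast (show 1 < p by omega)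
  have hϖ' : ‖ϖ‖ = (p : ℝ)⁻¹ := by
    rw [hϖ]; norm_num [Real.rpow_neg_one]
  rw [hϖ', inv_zpow', neg_sub] at hu
  have hlt : (p : ℝ) ^ (-1 : ℤ) < (p : ℝ) ^ ((1 : ℤ) - n₀) := by
    rw [zpow_neg_one]; exact hul.trans_le hu
  have := (zpow_lt_zpow_iff_right₀ hp1).1 hlt
  omega

/-- **`hrad` forces `lam ≤ −1` at `e = 1`, `p > 2`.** A log-unit `z` has `‖z‖ ≤ p⁻¹`, so `p^lam ≤ ‖z‖` gives `lam ≤ −1`.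
[cite: Mochizuki2012, IUTchIV Prop. 1.2 (i) p. 10] -/
theorem lam_le_neg_one_of_unramified (hp : 2 < p) (he : absRamificationIdx p K = 1) {lam : ℝ}
    (hrad : ∃ z ∈ (logUnits K : Set K), (p : ℝ) ^ lam ≤ ‖z‖) : lam ≤ -1 := by
  obtain ⟨z, hz, hzl⟩ := hrad
  rw [mem_logUnits_iff_norm_le_of_unramified p hp he z] at hz
  have hp1 : (1 : ℝ) < p := by exact_mod_cast (show 1 < p by omega)
  have h : (p : ℝ) ^ lam ≤ (p : ℝ) ^ (-1 : ℝ) := by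
    rw [Real.rpow_neg_one]; exact hzl.trans hz
  exact (Real.rpow_le_rpow_left_iff hp1).1 h

end LocalField

/-! ## §3. H⋆ = `SlotReachWindow` FAILS at every datum with an unramified odd bad place (certified dictionary, realising orders) -/

/-- **k2 VERDICT OBJECT for row 15.** Let a datum have a bad place `w` over an odd prime `p` whose completion `K` (any model
carrying the candidate's certification data at `w`) is absolutely unramified. If the candidate's dictionary at `w` is CERTIFIED
in its own sense (`e w = 1`, `‖ϖ‖ = p^{−1/e}`, a non-log-unit below `‖ϖ‖^(n₀−1)`, a log-unit above `p^lam`) and the orders are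
realising at label `2` (`4·mq ≤ mΘ 1`) with `mq ≥ 1`, then `SlotReachWindow` is FALSE. Same inequality `j²·m_q ≤ m_q` as
`Repair.CandInternal2Real.not_mem_jsq_smul_logShell_of_unramified`; by §4 the stratum is EMPTY at genuine initial Θ-data, and on the
synthetic row S-RAT S_H itself is refuted (p438525) — the bite is the ceiling (law (L2)), declared on the candidate's CARD.
[cite: Mochizuki2012, IUTchIV Prop. 1.2 (i) p. 10] [claim: Mochizuki2012, status: disputed] -/
theorem slotReachWindow_false_of_unramified_place {lstar : ℕ} (hl : 2 ≤ lstar)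
    {Fib : Nat.Primes → Type} {bad : ∀ pp, Fib pp → Prop} {e n₀ : ∀ pp, Fib pp → ℕ} {lam : ∀ pp, Fib pp → ℝ}
    {mΘ : ∀ pp, Fin lstar → Fib pp → ℤ} {mq : ∀ pp, Fib pp → ℤ}
    {p : ℕ} [hpp : Fact p.Prime] (hp : 2 < p) (w : Fib ⟨p, hpp.out⟩) (hw : bad ⟨p, hpp.out⟩ w)
    {K : Type} [NontriviallyNormedField K] [NormedAlgebra ℚ_[p] K] [IsUltrametricDist K] [ProperSpace K]
    (heK : Literature.IUT.LogVolume.absRamificationIdx p K = 1) (he : e ⟨p, hpp.out⟩ w = 1) {ϖ : K}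
    (hϖ : ‖ϖ‖ = (p : ℝ) ^ (-(1 : ℝ) / (e ⟨p, hpp.out⟩ w : ℝ)))
    (hsharp : ∃ u : K, ‖u‖ ≤ ‖ϖ‖ ^ ((n₀ ⟨p, hpp.out⟩ w : ℤ) - 1) ∧ u ∉ (Literature.IUT.LogVolume.logUnits K : Set K))
    (hrad : ∃ z ∈ (Literature.IUT.LogVolume.logUnits K : Set K), (p : ℝ) ^ (lam ⟨p, hpp.out⟩ w) ≤ ‖z‖)
    (hΘ : 4 * mq ⟨p, hpp.out⟩ w ≤ mΘ ⟨p, hpp.out⟩ ⟨1, hl⟩ w) (hq : 1 ≤ mq ⟨p, hpp.out⟩ w) :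
    ¬ SlotReachWindow lstar Fib bad e n₀ lam mΘ mq := by
  rw [he] at hϖ
  exact slotReachWindow_false_of_unramified_dictionary hl ⟨p, hpp.out⟩ w hw he
    (nZero_le_one_of_unramified hp heK hϖ hsharp) (lam_le_neg_one_of_unramified hp heK hrad) hΘ hq

/-! ## §4. Scope at the GENUINE `K`-level datum: no bad place is absolutely unramified (`e(K_w/ℚ_p) ≥ l ≥ 5`) -/

section Genuine

open NumberField IsDedekindDomain Literature.IUT.HodgeTheaters Literature.IUT.LogVolume Literature.NumberTheory.NumberFields Summit.ABC.IUTFork.Thm311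
  Summit.ABC.IUTFork.Thm311.Real Summit.ABC.IUTFork.Cor312 Summit.ABC.IUTFork.Cor312Prov

variable {F K Fbar : Type} [Field F] [NumberField F] [Field K] [NumberField K] [Algebra F K] [Field Fbar]
  [Algebra F Fbar] [Algebra K Fbar] {E : WeierstrassCurve F} [E.IsElliptic] {l : ℕ} {Pb : BadPlacePredicates K}
  (D : InitialThetaData F K Fbar E l Pb)

/-- **`e(K_w/ℚ_p) ≥ l` at every BAD place of the genuine datum** (norm-defined absolute ramification index of the completion
`kOf (pilotDataOfK D K) p x₀` = `e(w|p)` by `absRamificationIdx_rescaledCompletion`; `e(w|p) ≥ l` by abc-iut-w5-d054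
`Cor312Prov.l_le_ramificationIdx_int_of_over_VFbad`). [cite: Mochizuki2012, IUTchI Def. 3.1 (c) p. 62, Ex. 3.2 (iv) p. 71]
[cite: NeukirchANT1999, Ch. II Prop. (6.8)] -/
theorem l_le_absRamificationIdx_kOf_of_mem_S (p : ℕ) [hp : Fact p.Prime]
    (x₀ : (thetaIndex (pilotDataOfK D K)).Fibre (.inr ⟨p, hp.out⟩))
    (hx : placeOf (pilotDataOfK D K) p x₀ ∈ (pilotDataOfK D K).S) :
    l ≤ absRamificationIdx p (kOf (pilotDataOfK D K) p x₀) := by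
  set w := placeOf (pilotDataOfK D K) p x₀ with hwdef
  have hpx : ((p : ℕ) : 𝓞 K) ∈ w.asIdeal := natCast_mem_placeOf (pilotDataOfK D K) p x₀
  have hekOf : absRamificationIdx p (kOf (pilotDataOfK D K) p x₀) = w.asIdeal.ramificationIdx ℤ := by
    rw [show absRamificationIdx p (kOf (pilotDataOfK D K) p x₀) = absRamificationIdx p (RescaledCompletion K p w hpx) from rfl,
      absRamificationIdx_rescaledCompletion]
  have hv : FinitePlace.mk (finBelow F K w) ∈ D.VFbad := (mem_pilotDataOfK_S_iff D K w).mp hx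
  rw [hekOf]
  exact l_le_ramificationIdx_int_of_over_VFbad D w hv

/-- **Hence `e(K_w/ℚ_p) ≠ 1` at every bad place of the genuine datum** (`l ≥ 5`, `InitialThetaData.five_le_l`): the shared hypothesis
`absRamificationIdx p K_w = 1` of §3 and of every landed member of the unramified-odd family is UNSATISFIABLE on the genuine rows.
[cite: Mochizuki2012, IUTchI Def. 3.1 (c) p. 62] -/
theorem absRamificationIdx_kOf_ne_one_of_mem_S (p : ℕ) [hp : Fact p.Prime]
    (x₀ : (thetaIndex (pilotDataOfK D K)).Fibre (.inr ⟨p, hp.out⟩))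
    (hx : placeOf (pilotDataOfK D K) p x₀ ∈ (pilotDataOfK D K).S) :
    absRamificationIdx p (kOf (pilotDataOfK D K) p x₀) ≠ 1 := by
  have h5 := D.five_le_l
  have hl := l_le_absRamificationIdx_kOf_of_mem_S D p x₀ hx
  omega

end Genuine

/-! ## §5. Sanity: the kill is EXACTLY the unramified corner — one tame ramified place already escapes it -/

/-- At `e = 2` (tame, `p ≥ 5`), `n₀ = 1`, `lam = −1/2`, `j = 2`, `m_q = 1`, `m_Θ = 4` the `(w, 2)`-clause HOLDS
(`⌊3/2⌋ = 1 ≤ 1/2 − 1/2 + 2·(−1/2 + 1) = 1`): the unramified kill does not propagate to ramified places —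
it is the `e_w = 1` corner of the tame band `e·⌊(mΘ−1)/e⌋ + 1 − j·(e−1) ≤ m_q` (`RHSlotReach.clause_iff_tame`). [folklore] -/
example : (((4 - 1 : ℤ) / (2 : ℤ) : ℤ) : ℝ) ≤ (1 : ℝ) / 2 + (-(1 : ℝ) / 2)
    + ∑ _a : Fin 2, ((-(1 : ℝ) / 2) + ((-((-(1 : ℤ)) / (2 : ℤ)) : ℤ) : ℝ)) := by
  simp only [Finset.sum_const, Finset.card_univ, Fintype.card_fin, nsmul_eq_mul]
  norm_num

end Summit.ABC.IUTFork.Repair.RHSlotReachUnramified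

end
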